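import Mathlib.Analysis.Calculus.MeanValue
import Mathlib.Analysis.Normed.Ring.Units
import Mathlib.Topology.MetricSpace.Contracting
import HarnessLib

/-!
# The radii-polynomial form of the Newton–Kantorovich theorem (a-posteriori validation with an
# approximate inverse)

Topic `Literature/Analysis/Calculus`.  This file **proves**, for a map `F : X → Y` between real normed
spaces with `X` complete, the fixed-point theorem that underlies "rigorous numerics" existence proofs
(validated continuation, computer-assisted proofs in dynamics): given a numerical approximate zero `x̄`,
an INJECTIVE bounded linear "approximate inverse" `A : Y → X` of `DF(x̄)` (in applications a
finite matrix glued to the identity or to a diagonal tail — it need not be invertible, only injective),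
a defect bound `‖A F(x̄)‖ ≤ Y₀` and a bound `‖I − A DF(x)‖ ≤ Z` on the closed ball `B̄_r(x̄)`, the
inequality `Y₀ + Z·r < r` forces a unique zero of `F` in `B̄_r(x̄)`.  Two printed forms are covered.

(1) The **sup form** (`existsUnique_zero_of_newtonLike`).  This is the statement used, e.g., in
A. Hungria, J.-P. Lessard, J. D. Mireles James, *Rigorous numerics for analytic solutions of
differential equations: the radii polynomial approach*, Math. Comp. **85** (2016) 1427–1459
[HungriaLessardMirelesJames2016], §3, whose standing assumptions (§3.1, preprint p. 10) and Proposition 1 (preprint p. 11) read: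

> "we take `A` as given and define the Newton-like operator `T : X → X` by `T(x) = x − AF(x)` (3.5)
> for `x` in some neighborhood of `x̄`.  More formally, the framework in which we prove existence of
> solutions is under the assumptions that • `A` is an injective linear operator such that `AF : X → X`;
> • `T ∈ C¹(X)`.  The injectivity of `A` implies that `x` is a solution of `F(x) = 0` if and only if it
> is a fixed point of `T`."
> "**Proposition 1.** Consider the bounds `Y`, `Z(r) ∈ ℝ^{j₁+j₂}` satisfying the component-wise
> inequalities (3.6) [`‖(T(x̄) − x̄)_j‖ ≤ Y_j`, `sup_{b,c ∈ B(r)} ‖DT_j(x̄ + b) c‖ ≤ Z_j(r)`].  If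
> `max_j {Z_j(r) + Y_j} < r`, then `T : B_x̄(r) → B_x̄(r)` is a contraction.  Moreover, there exists a
> unique `x̃ ∈ B_x̄(r)` such that `F(x̃) = 0`."

Here it is proved for ONE component (`j₁ + j₂ = 1`, an arbitrary real Banach space `X` in place of
their `ℝ^{j₁} × (ℓ¹_ν)^{j₂}`), with `Z(r)` in the form `r · sup_{x ∈ B̄_r(x̄)} ‖I − A·DF(x)‖` (so their
hypothesis `Z(r) + Y < r` is our `Y₀ + Z·r < r`); the same statement is Theorem 2.1 of S. Day,
J.-P. Lessard, K. Mischaikow, *Validated continuation for equilibria of PDEs*, SIAM J. Numer. Anal.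
**45** (2007) 1398–1424 [DayLessardMischaikow2007] and goes back to N. Yamamoto, SIAM J. Numer. Anal.
**35** (1998) 2004–2013.  The proof is the printed one: the mean value inequality makes `T` a
`Z`-Lipschitz self-map of the complete set `B̄_r(x̄)`, `Z < 1`, Banach's fixed point theorem, and
injectivity of `A` to pass between fixed points of `T` and zeros of `F`.

(2) The **radii-polynomial (`Y₀, Z₀, Z₁, Z₂`) form** (`existsUnique_zero_of_radiiPolynomial`),
verbatim Theorem 8 of R. Calleja, C. García-Azpeitia, J.-P. Lessard, J. D. Mireles James, *Torus knot
choreographies in the n-body problem*, Nonlinearity **34** (2021) 313–348 (arXiv:1901.03738, §3)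
[CallejaEtAl2021]:

> "**Theorem 8 (Radii Polynomial Approach).** For `x̄ ∈ X` and `r > 0` assume that `F : X → Y` is
> Fréchet differentiable on the ball `B_r(x̄)`.  Consider bounded linear operators `A† ∈ B(X,Y)` and
> `A ∈ B(Y,X)`, where `A†` is an approximation of `DF(x̄)` and `A` is an approximate inverse of
> `DF(x̄)`.  Observe that `AF : X → X`.  Assume that `A` is injective.  Let `Y₀, Z₀, Z₁, Z₂ ≥ 0` be
> bounds satisfying `‖AF(x̄)‖_X ≤ Y₀`, `‖I − AA†‖_{B(X)} ≤ Z₀`, `‖A[DF(x̄) − A†]‖_{B(X)} ≤ Z₁`,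
> `‖A[DF(x̄ + b) − DF(x̄)]‖_{B(X)} ≤ Z₂ r` for all `b ∈ B_r(0)`.  Define the radii polynomial
> `p(r) := Z₂r² + (Z₁ + Z₀ − 1)r + Y₀`.  If there exists `0 < r₀ ≤ r` such that `p(r₀) < 0`, then there
> exists a unique `x̃ ∈ B_{r₀}(x̄)` such that `F(x̃) = 0`."

(their `B_r(y)` is the CLOSED ball; proof: "Appendix A of [HLM 2016]": `‖I − A DF(x)‖ ≤ Z₀ + Z₁ + Z₂ r`
on the ball by the triangle inequality, then (1)).  It is proved here at `r₀ = r` — the case in which it is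
applied (one fixes `r`, verifies the four bounds on `B_r`, and checks `p(r) < 0`); for `r₀ < r` the printed
hypothesis `‖A[DF(x̄+b) − DF(x̄)]‖ ≤ Z₂ r` (with `r`, not `‖b‖` or `r₀`) does not by itself give the
contraction estimate on `B_{r₀}`, and one simply re-instantiates the theorem at `r₀`.  Corollary 9 there
(non-degeneracy: `A DF(x̃)` is invertible, indeed `‖I − A DF(x)‖ < 1` on the ball) is
`isInvertible_comp_of_newtonLike`.

(3) The **Newton-operator window form** (`existsUnique_zero_of_aposterioriValidation`), the abstract
part of Theorem 2.15 of J. B. van den Berg, M. Breden, J.-P. Lessard, L. van Veen, *Spontaneous periodic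
orbits in the Navier–Stokes flow*, J. Nonlinear Sci. **31** (2021) Paper No. 41 (arXiv:1902.00384, §2.4)
[BergBredenLessardVeen2021] — the a-posteriori theorem behind the first computer-assisted proofs of
time-periodic Navier–Stokes solutions (Taylor–Green forcing on `𝕋³`, their Thm. 1.1):

> "**Theorem 2.15.** Let `η > 1`. With the notations of the previous sections, assume there exist `W̄ ∈ 𝕏`
> and non-negative constants `Y₀, Z₀, Z₁` and `Z₂` such that `‖A𝓕(W̄)‖_𝕏 ≤ Y₀`, `‖I − AA†‖_{B(𝕏,𝕏)} ≤ Z₀`,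
> `‖A(D𝓕(W̄) − A†)‖_{B(𝕏,𝕏)} ≤ Z₁`, `‖A(D𝓕(W) − D𝓕(W̄))‖_{B(𝕏,𝕏)} ≤ Z₂‖W − W̄‖_𝕏` for all `W ∈ 𝕏`.
> [three NS-specific riders: `f` time independent with zero space average; `W̄ ∈ 𝕏^{div}`;
> `γ_*`-symmetry of `ω̂`, `W̄`.]  If `Z₀ + Z₁ < 1` and `2Y₀Z₂ < (1 − (Z₀+Z₁))²`, then, for all
> `r ∈ [r_min, r_max)` there exists a unique `W̃ ∈ B_𝕏(W̄, r)` such that `𝓕(W̃) = 0`, where `B_𝕏(W̄, r)` is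
> the closed ball of `𝕏`, centered at `W̄` and of radius `r`, and
> `r_min = (1 − (Z₀+Z₁) − √((1 − (Z₀+Z₁))² − 2Y₀Z₂))/Z₂`, `r_max = (1 − (Z₀+Z₁))/Z₂`.
> [riders: `W̃ ∈ 𝕏^{div}`; `(u, p)` is a `2π/Ω̃`-periodic, real valued and analytic solution of NS.]"

Rendered for `F : X → Y` (`X` real Banach, `Y` real normed; the paper: `𝕏` and `𝕏_{−2,−1}`, weighted
sequence spaces of space-time Fourier coefficients), `A : Y →L X`, `A† : X →L Y`, with `A` INJECTIVE as an
explicit hypothesis (in the paper this is derived in the first lines of the proof from the block structure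
"finite matrix ⊕ exact diagonal tail") and `Z₂ > 0` (the printed `r_min`, `r_max` divide by `Z₂`).  The
NS-specific riders are NOT rendered (they live in the paper's functional setting, §2.1–2.3).  Compared with
(2), the printed self-map condition is `½Z₂r² + (Z₀+Z₁−1)r + Y₀ ≤ 0` — sharper by the factor `½` coming
from `∫₀¹ t dt` in the integral mean value estimate — together with the contraction window `r < r_max`.
Proof as printed (self-map of `B̄_r(W̄)` by the path estimate, contraction constant `(Z₀+Z₁) + Z₂r < 1`,
Banach), run with the Newton-like operator `T = I − AF` of (1) in place of the paper's `I − D𝓕(W̄)⁻¹𝓕`: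
the same two estimates hold for it verbatim and only injectivity of `A` is needed; the path estimate is
Mathlib's ODE-comparison lemma `image_norm_le_of_norm_deriv_right_le_deriv_boundary`.

USE (cell pub-oswblow, CAP-FLUIDS; honest framing of that cell: "1-D model (gCLM/OSW), computer-assisted;
not Euler/NS"): this is "Theorem RP" of the cell's FRAME.md §6, the theorem whose hypotheses the
certificate for `Literature.Analysis.FluidPDE.OkamotoSakajoWunsch2008.AnalyticSeparableProfileA3`
verifies in `X = ℓ¹_ν × ℝ²`.  Compare `Literature.Analysis.Calculus.existsUnique_zero_of_simplifiedNewton`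
(Magnus 2022, Prop. 6.7: exact inverse `A = DF(a)⁻¹` and a Lipschitz constant for `DF`), of which (1) is
the approximate-inverse generalisation used in validated numerics.

## Contents (all proved; no named facts)
* `newtonLikeMap A F` : `T(x) = x − A(F x)`; `newtonLikeMap_eq_self_iff` (fixed points = zeros, `A` injective);
  `hasFDerivAt_newtonLikeMap` (`DT(x) = I − A ∘ DF(x)`).
* `existsUnique_zero_of_newtonLike` : form (1) — existence, uniqueness in `B̄_r(x̄)`, convergence of the
  Newton-like iterates from `x̄`, under `0 ≤ r`, `‖A F(x̄)‖ ≤ Y₀`, `‖I − A∘DF(x)‖ ≤ Z` on the ball, `Y₀ + Z r < r`.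
* `isInvertible_comp_of_norm_id_sub_lt`, `isInvertible_comp_of_newtonLike` : `‖I − A∘B‖ < 1 ⇒ A∘B`
  invertible (Neumann series); on the ball of (1), `A ∘ DF(x)` is invertible (Corollary 9 of [CallejaEtAl2021]).
* `existsUnique_zero_of_radiiPolynomial` : form (2) at `r₀ = r`.
* `norm_id_sub_comp_le_of_bounds` : `‖I − A∘DF(x)‖ ≤ Z₀ + Z₁ + Z₂‖x − x̄‖` from the three printed bounds;
  `existsUnique_zero_of_aposterioriValidation` : form (3), for every `r ∈ [r_min, r_max)`.

## Mathlib search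
`Convex.norm_image_sub_le_of_norm_hasFDerivWithin_le` (mean value inequality), `ContractingWith.exists_fixedPoint'`
(Banach on a complete subset), `Units.oneSub` (Neumann series); no radii-polynomial / Newton–Kantorovich
statement with an approximate inverse exists in Mathlib or in `Literature` (`lean search 'radii|Kantorovich|approximate inverse'`).

## References
* [HungriaLessardMirelesJames2016] Math. Comp. 85 (2016) 1427–1459, doi:10.1090/mcom/3046, §3, Prop. 1.
* [BergBredenLessardVeen2021] J. Nonlinear Sci. 31 (2021) Paper No. 41, doi:10.1007/s00332-021-09695-4
  (arXiv:1902.00384 = [BergEtAl2019]), §2.4 Thm. 2.15 (arXiv numbering).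
* [CallejaEtAl2021] Nonlinearity 34 (2021) 313–348, doi:10.1088/1361-6544/abcb08 (arXiv:1901.03738), Thm. 8, Cor. 9.
* [DayLessardMischaikow2007] SIAM J. Numer. Anal. 45 (2007) 1398–1424, Thm. 2.1.
* N. Yamamoto, SIAM J. Numer. Anal. 35 (1998) 2004–2013.
-/

noncomputable section

open Metric Set Filter
open scoped Topology

namespace Literature.Analysis.Calculus

variable {X Y : Type*} [NormedAddCommGroup X] [NormedSpace ℝ X]
  [NormedAddCommGroup Y] [NormedSpace ℝ Y]

/-- The **Newton-like operator** `T(x) = x − A F(x)` attached to `F : X → Y` and a bounded linear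
`A : Y → X` (an approximate inverse of `DF(x̄)`), eq. (3.5) of [HungriaLessardMirelesJames2016].
[cite: HungriaLessardMirelesJames2016, §3 eq. (3.5)] -/
def newtonLikeMap (A : Y →L[ℝ] X) (F : X → Y) (x : X) : X :=
  x - A (F x)

/-- Unfolding lemma for `newtonLikeMap`. [folklore] -/
theorem newtonLikeMap_apply (A : Y →L[ℝ] X) (F : X → Y) (x : X) :
    newtonLikeMap A F x = x - A (F x) :=
  rfl

/-- "The injectivity of `A` implies that `x` is a solution of `F(x) = 0` if and only if it is a fixed
point of `T`" ([HungriaLessardMirelesJames2016], §3). [cite: HungriaLessardMirelesJames2016, §3 (after eq. (3.5))] -/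
theorem newtonLikeMap_eq_self_iff {A : Y →L[ℝ] X} (hA : Function.Injective A) (F : X → Y) (x : X) :
    newtonLikeMap A F x = x ↔ F x = 0 := by
  rw [newtonLikeMap_apply, sub_eq_self]
  constructor
  · intro h
    exact hA (by rw [h, map_zero])
  · intro h
    rw [h, map_zero]

/-- `DT(x) = I − A ∘ DF(x)` wherever `F` has Fréchet derivative `DF(x)`. [folklore] -/
theorem hasFDerivAt_newtonLikeMap {A : Y →L[ℝ] X} {F : X → Y} {F' : X →L[ℝ] Y} {x : X}
    (hF : HasFDerivAt F F' x) :
    HasFDerivAt (newtonLikeMap A F) (ContinuousLinearMap.id ℝ X - A.comp F') x :=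
  (hasFDerivAt_id x).sub (A.hasFDerivAt.comp x hF)

/-- **Neumann series**: if `‖I − A∘B‖ < 1` in `B(X)`, `X` a Banach space, then `A ∘ B` is invertible
(`A ∘ B = I − (I − A∘B)`, `Units.oneSub`). [folklore] -/
theorem isInvertible_comp_of_norm_id_sub_lt [CompleteSpace X] {A : Y →L[ℝ] X} {B : X →L[ℝ] Y}
    (h : ‖ContinuousLinearMap.id ℝ X - A.comp B‖ < 1) : (A.comp B).IsInvertible := by
  set T : X →L[ℝ] X := ContinuousLinearMap.id ℝ X - A.comp B with hT
  have h1 : ‖T‖ < 1 := h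
  set u : (X →L[ℝ] X)ˣ := Units.oneSub T h1 with hu
  refine ⟨ContinuousLinearEquiv.unitsEquiv ℝ X u, ?_⟩
  ext v
  have huv : (u : X →L[ℝ] X) v = v - T v := by
    simp [hu, Units.oneSub]
  simp [huv, hT]

section Main

variable [CompleteSpace X]

/-- **Newton–Kantorovich, radii-polynomial / sup form** ([HungriaLessardMirelesJames2016] Prop. 1 with
one component; [DayLessardMischaikow2007] Thm. 2.1).  Let `X` be a real Banach space, `Y` a real normed
space, `F : X → Y` with a Fréchet derivative `F' x` at every point of the closed ball `B̄_r(x̄)` (`r ≥ 0`),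
and `A : Y →L X` injective.  If `‖A (F x̄)‖ ≤ Y₀`, `‖I − A ∘ F'(x)‖ ≤ Z` for all `x ∈ B̄_r(x̄)`, and
`Y₀ + Z·r < r`, then: `F` has a zero `x⋆ ∈ B̄_r(x̄)`; it is the only zero of `F` in `B̄_r(x̄)`; and the
Newton-like iterates `x_{n+1} = x_n − A F(x_n)` from `x₀ = x̄` converge to `x⋆`.  (The map
`T = I − A F` is a `Z`-contraction of `B̄_r(x̄)` into itself, `Z < 1`.)
[cite: HungriaLessardMirelesJames2016, §3 Prop. 1] -/
theorem existsUnique_zero_of_newtonLike {F : X → Y} {F' : X → X →L[ℝ] Y} {xbar : X}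
    {A : Y →L[ℝ] X} {Y₀ Z r : ℝ} (hr : 0 ≤ r) (hA : Function.Injective A)
    (hF : ∀ x ∈ closedBall xbar r, HasFDerivAt F (F' x) x)
    (hY : ‖A (F xbar)‖ ≤ Y₀)
    (hZ : ∀ x ∈ closedBall xbar r, ‖ContinuousLinearMap.id ℝ X - A.comp (F' x)‖ ≤ Z)
    (h : Y₀ + Z * r < r) :
    ∃ x ∈ closedBall xbar r, F x = 0 ∧ (∀ y ∈ closedBall xbar r, F y = 0 → y = x) ∧
      Tendsto (fun n => (newtonLikeMap A F)^[n] xbar) atTop (𝓝 x) := by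
  set g : X → X := newtonLikeMap A F with hg
  have hY₀ : 0 ≤ Y₀ := le_trans (norm_nonneg _) hY
  have hZ₀ : 0 ≤ Z := le_trans (norm_nonneg _) (hZ xbar (mem_closedBall_self hr))
  have hrpos : 0 < r := by
    rcases hr.eq_or_lt with h0 | h0
    · exfalso
      rw [← h0] at h
      linarith
    · exact h0
  have hZ1 : Z < 1 := by nlinarith
  -- `g` is `Z`-Lipschitz on the ball (mean value inequality)
  have hlip : ∀ x ∈ closedBall xbar r, ∀ y ∈ closedBall xbar r, ‖g y - g x‖ ≤ Z * ‖y - x‖ :=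
    fun x hx y hy => (convex_closedBall xbar r).norm_image_sub_le_of_norm_hasFDerivWithin_le
      (fun z hz => (hasFDerivAt_newtonLikeMap (hF z hz)).hasFDerivWithinAt) hZ hx hy
  -- `g` maps the ball into itself
  have hga : g xbar - xbar = -A (F xbar) := by
    simp [hg, newtonLikeMap_apply]
  have hmaps : MapsTo g (closedBall xbar r) (closedBall xbar r) := by
    intro x hx
    have hxa : ‖x - xbar‖ ≤ r := mem_closedBall_iff_norm.1 hx
    rw [mem_closedBall_iff_norm]
    calc ‖g x - xbar‖ = ‖(g x - g xbar) + (g xbar - xbar)‖ := by abel_nf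
      _ ≤ ‖g x - g xbar‖ + ‖g xbar - xbar‖ := norm_add_le _ _
      _ ≤ Z * ‖x - xbar‖ + ‖A (F xbar)‖ := by
          gcongr
          · exact hlip xbar (mem_closedBall_self hr) x hx
          · rw [hga, norm_neg]
      _ ≤ Z * r + Y₀ := by gcongr
      _ ≤ r := by linarith
  -- Banach's fixed point theorem on the complete subset `closedBall xbar r`
  obtain ⟨K, hK⟩ : ∃ K : NNReal, (K : ℝ) = Z := ⟨⟨Z, hZ₀⟩, rfl⟩
  have hK₁ : K < 1 := by
    rw [← NNReal.coe_lt_coe, hK, NNReal.coe_one]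
    exact hZ1
  have hlipK : LipschitzOnWith K g (closedBall xbar r) := by
    refine LipschitzOnWith.of_dist_le_mul fun x hx y hy => ?_
    rw [dist_eq_norm, dist_eq_norm, hK]
    exact hlip y hy x hx
  have hc : ContractingWith K (hmaps.restrict g _ _) := ⟨hK₁, hlipK.mapsToRestrict hmaps⟩
  obtain ⟨x, hx, hfix, htend, -⟩ :=
    hc.exists_fixedPoint' isClosed_closedBall.isComplete hmaps (mem_closedBall_self hr)
      (edist_ne_top _ _)
  have hfx : F x = 0 := (newtonLikeMap_eq_self_iff hA F x).1 hfix
  refine ⟨x, hx, hfx, fun y hy hfy => ?_, htend⟩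
  -- uniqueness: two fixed points of a strict contraction coincide
  have hgy : g y = y := (newtonLikeMap_eq_self_iff hA F y).2 hfy
  have hle : ‖y - x‖ ≤ Z * ‖y - x‖ := by
    have := hlip x hx y hy
    rwa [hgy, show g x = x from hfix] at this
  have h0 : ‖y - x‖ = 0 := by
    nlinarith [norm_nonneg (y - x)]
  exact sub_eq_zero.1 (norm_eq_zero.1 h0)

/-- **Non-degeneracy along the ball** ([CallejaEtAl2021] Cor. 9): under the hypotheses of
`existsUnique_zero_of_newtonLike`, `‖I − A ∘ F'(x)‖ ≤ Z < 1` on `B̄_r(x̄)`, so `A ∘ F'(x)` is invertible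
there — in particular at the zero `x⋆`, and `F'(x⋆)` is injective. [cite: CallejaEtAl2021, Cor. 9] -/
theorem isInvertible_comp_of_newtonLike {F : X → Y} {F' : X → X →L[ℝ] Y} {xbar x : X}
    {A : Y →L[ℝ] X} {Y₀ Z r : ℝ} (hr : 0 ≤ r)
    (hY : ‖A (F xbar)‖ ≤ Y₀)
    (hZ : ∀ x ∈ closedBall xbar r, ‖ContinuousLinearMap.id ℝ X - A.comp (F' x)‖ ≤ Z)
    (h : Y₀ + Z * r < r) (hx : x ∈ closedBall xbar r) : (A.comp (F' x)).IsInvertible := by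
  have hY₀ : 0 ≤ Y₀ := le_trans (norm_nonneg _) hY
  have hrpos : 0 < r := by
    rcases hr.eq_or_lt with h0 | h0
    · exfalso
      rw [← h0] at h
      linarith
    · exact h0
  have hZ1 : Z < 1 := by nlinarith
  exact isInvertible_comp_of_norm_id_sub_lt (lt_of_le_of_lt (hZ x hx) hZ1)

/-- **Theorem 8 of [CallejaEtAl2021] (Radii Polynomial Approach), at `r₀ = r`.**  `X` a real Banach
space, `Y` a real normed space, `x̄ ∈ X`, `r > 0`, `F : X → Y` Fréchet differentiable on the closed ball
`B̄_r(x̄)` with derivative `F'`, `A† ∈ B(X,Y)`, `A ∈ B(Y,X)` injective, and bounds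
`‖A F(x̄)‖ ≤ Y₀`, `‖I − A A†‖ ≤ Z₀`, `‖A (F'(x̄) − A†)‖ ≤ Z₁`, `‖A (F'(x̄ + b) − F'(x̄))‖ ≤ Z₂ r` for all
`‖b‖ ≤ r`.  If the radii polynomial is negative at `r`, `Z₂ r² + (Z₁ + Z₀ − 1) r + Y₀ < 0`, then `F` has a
unique zero in `B̄_r(x̄)`, and `A ∘ F'` is invertible at it (Cor. 9).  Proof as printed (App. A of
[HungriaLessardMirelesJames2016]): `‖I − A F'(x)‖ ≤ Z₀ + Z₁ + Z₂ r` on the ball, then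
`existsUnique_zero_of_newtonLike`. [cite: CallejaEtAl2021, Thm. 8 and Cor. 9 (§3)] -/
theorem existsUnique_zero_of_radiiPolynomial {F : X → Y} {F' : X → X →L[ℝ] Y} {xbar : X}
    {A : Y →L[ℝ] X} {Adag : X →L[ℝ] Y} {Y₀ Z₀ Z₁ Z₂ r : ℝ} (hr : 0 < r) (hA : Function.Injective A)
    (hF : ∀ x ∈ closedBall xbar r, HasFDerivAt F (F' x) x)
    (hY : ‖A (F xbar)‖ ≤ Y₀)
    (hZ₀ : ‖ContinuousLinearMap.id ℝ X - A.comp Adag‖ ≤ Z₀)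
    (hZ₁ : ‖A.comp (F' xbar - Adag)‖ ≤ Z₁)
    (hZ₂ : ∀ b : X, ‖b‖ ≤ r → ‖A.comp (F' (xbar + b) - F' xbar)‖ ≤ Z₂ * r)
    (hp : Z₂ * r ^ 2 + (Z₁ + Z₀ - 1) * r + Y₀ < 0) :
    ∃ x ∈ closedBall xbar r, F x = 0 ∧ (∀ y ∈ closedBall xbar r, F y = 0 → y = x) ∧
      (A.comp (F' x)).IsInvertible ∧ Tendsto (fun n => (newtonLikeMap A F)^[n] xbar) atTop (𝓝 x) := by
  -- the bound `‖I − A F'(x)‖ ≤ Z₀ + Z₁ + Z₂ r` on the ball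
  have hZ : ∀ x ∈ closedBall xbar r,
      ‖ContinuousLinearMap.id ℝ X - A.comp (F' x)‖ ≤ Z₀ + Z₁ + Z₂ * r := by
    intro x hx
    have hb : ‖x - xbar‖ ≤ r := mem_closedBall_iff_norm.1 hx
    have h2 := hZ₂ (x - xbar) hb
    have hx' : xbar + (x - xbar) = x := by abel
    rw [hx'] at h2
    have hsplit : ContinuousLinearMap.id ℝ X - A.comp (F' x) =
        (ContinuousLinearMap.id ℝ X - A.comp Adag) + (-(A.comp (F' xbar - Adag)))
          + (-(A.comp (F' x - F' xbar))) := by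
      ext v
      simp only [sub_apply, add_apply, neg_apply, ContinuousLinearMap.comp_apply,
        ContinuousLinearMap.id_apply, map_sub]
      abel
    rw [hsplit]
    calc ‖(ContinuousLinearMap.id ℝ X - A.comp Adag) + (-(A.comp (F' xbar - Adag)))
            + (-(A.comp (F' x - F' xbar)))‖
          ≤ ‖ContinuousLinearMap.id ℝ X - A.comp Adag‖ + ‖-(A.comp (F' xbar - Adag))‖
            + ‖-(A.comp (F' x - F' xbar))‖ := norm_add₃_le
      _ ≤ Z₀ + Z₁ + Z₂ * r := by
          rw [norm_neg, norm_neg]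
          gcongr
  have h : Y₀ + (Z₀ + Z₁ + Z₂ * r) * r < r := by nlinarith
  obtain ⟨x, hx, hfx, huniq, htend⟩ :=
    existsUnique_zero_of_newtonLike hr.le hA hF hY hZ h
  exact ⟨x, hx, hfx, huniq, isInvertible_comp_of_newtonLike hr.le hY hZ h hx, htend⟩

omit [CompleteSpace X] in
/-- The three printed bounds give `‖I − A∘DF(x)‖ ≤ Z₀ + Z₁ + Z₂‖x − x̄‖` (triangle inequality:
`I − A DF(x) = (I − AA†) − A(DF(x̄) − A†) − A(DF(x) − DF(x̄))`; proof of Thm. 2.15, estimate of `DT`).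
[cite: BergBredenLessardVeen2021, Thm. 2.15 (proof; arXiv:1902.00384 §2.4)] -/
theorem norm_id_sub_comp_le_of_bounds {F' : X → X →L[ℝ] Y} {xbar : X} {A : Y →L[ℝ] X}
    {Adag : X →L[ℝ] Y} {Z₀ Z₁ Z₂ : ℝ}
    (hZ₀ : ‖ContinuousLinearMap.id ℝ X - A.comp Adag‖ ≤ Z₀)
    (hZ₁ : ‖A.comp (F' xbar - Adag)‖ ≤ Z₁)
    (hZ₂ : ∀ x : X, ‖A.comp (F' x - F' xbar)‖ ≤ Z₂ * ‖x - xbar‖) (x : X) :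
    ‖ContinuousLinearMap.id ℝ X - A.comp (F' x)‖ ≤ Z₀ + Z₁ + Z₂ * ‖x - xbar‖ := by
  have hsplit : ContinuousLinearMap.id ℝ X - A.comp (F' x) =
      (ContinuousLinearMap.id ℝ X - A.comp Adag) + (-(A.comp (F' xbar - Adag)))
        + (-(A.comp (F' x - F' xbar))) := by
    ext v
    simp only [sub_apply, add_apply, neg_apply, ContinuousLinearMap.comp_apply,
      ContinuousLinearMap.id_apply, map_sub]
    abel
  rw [hsplit]
  calc ‖(ContinuousLinearMap.id ℝ X - A.comp Adag) + (-(A.comp (F' xbar - Adag)))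
          + (-(A.comp (F' x - F' xbar)))‖
        ≤ ‖ContinuousLinearMap.id ℝ X - A.comp Adag‖ + ‖-(A.comp (F' xbar - Adag))‖
          + ‖-(A.comp (F' x - F' xbar))‖ := norm_add₃_le
    _ ≤ Z₀ + Z₁ + Z₂ * ‖x - xbar‖ := by
        rw [norm_neg, norm_neg]
        gcongr
        exact hZ₂ x

/-- **Theorem 2.15 of [BergBredenLessardVeen2021] (a-posteriori validation, Newton-operator window form),
abstract part.**  `X` a real Banach space, `Y` a real normed space, `F : X → Y` Fréchet differentiable
everywhere with derivative `F'`, `x̄ ∈ X`, `A : Y →L X` injective, `A† : X →L Y`, and constants with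
`‖A F(x̄)‖ ≤ Y₀`, `‖I − AA†‖ ≤ Z₀`, `‖A(F'(x̄) − A†)‖ ≤ Z₁`, `‖A(F'(x) − F'(x̄))‖ ≤ Z₂‖x − x̄‖` for all `x`,
`Z₂ > 0`.  If `Z₀ + Z₁ < 1` and `2Y₀Z₂ < (1 − (Z₀+Z₁))²`, then for every
`r ∈ [r_min, r_max)`, `r_min = (1 − (Z₀+Z₁) − √((1−(Z₀+Z₁))² − 2Y₀Z₂))/Z₂`, `r_max = (1 − (Z₀+Z₁))/Z₂`,
`F` has exactly one zero in the closed ball `B̄_r(x̄)`.  (Printed for the space-time Fourier formulation of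
forced Navier–Stokes on `𝕋³`; the NS riders — divergence-free, real-valuedness, periodic analytic solution —
are not rendered; `A` injective is an explicit hypothesis here, derived from the diagonal-tail structure
there.)  Proof: the printed two estimates (`T` maps `B̄_r(x̄)` into itself since
`½Z₂r² + (Z₀+Z₁)r + Y₀ ≤ r` on the window, and is a `((Z₀+Z₁) + Z₂r)`-contraction, `< 1` for `r < r_max`)
for the Newton-like operator `T = I − AF`, then Banach's fixed point theorem and injectivity of `A`.
[cite: BergBredenLessardVeen2021, Thm. 2.15 (§2.4; arXiv:1902.00384 numbering)] -/
theorem existsUnique_zero_of_aposterioriValidation {F : X → Y} {F' : X → X →L[ℝ] Y} {xbar : X}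
    {A : Y →L[ℝ] X} {Adag : X →L[ℝ] Y} {Y₀ Z₀ Z₁ Z₂ r : ℝ} (hA : Function.Injective A)
    (hF : ∀ x, HasFDerivAt F (F' x) x)
    (hY : ‖A (F xbar)‖ ≤ Y₀)
    (hZ₀ : ‖ContinuousLinearMap.id ℝ X - A.comp Adag‖ ≤ Z₀)
    (hZ₁ : ‖A.comp (F' xbar - Adag)‖ ≤ Z₁)
    (hZ₂ : ∀ x : X, ‖A.comp (F' x - F' xbar)‖ ≤ Z₂ * ‖x - xbar‖) (hZ₂pos : 0 < Z₂)
    (h₁ : Z₀ + Z₁ < 1) (h₂ : 2 * Y₀ * Z₂ < (1 - (Z₀ + Z₁)) ^ 2)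
    (hrmin : (1 - (Z₀ + Z₁) - Real.sqrt ((1 - (Z₀ + Z₁)) ^ 2 - 2 * Y₀ * Z₂)) / Z₂ ≤ r)
    (hrmax : r < (1 - (Z₀ + Z₁)) / Z₂) :
    ∃ x ∈ closedBall xbar r, F x = 0 ∧ ∀ y ∈ closedBall xbar r, F y = 0 → y = x := by
  set Z := Z₀ + Z₁ with hZdef
  set g : X → X := newtonLikeMap A F with hg
  have hY₀ : 0 ≤ Y₀ := le_trans (norm_nonneg _) hY
  have hZ0' : 0 ≤ Z₀ := le_trans (norm_nonneg _) hZ₀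
  have hZ1' : 0 ≤ Z₁ := le_trans (norm_nonneg _) hZ₁
  have hZ' : 0 ≤ Z := by rw [hZdef]; positivity
  have ha : 0 < 1 - Z := by linarith
  -- the window: `0 ≤ r`, `Z + Z₂ r < 1` and `½ Z₂ r² + Z r + Y₀ ≤ r`
  set D := (1 - Z) ^ 2 - 2 * Y₀ * Z₂ with hDdef
  have hD : 0 < D := by rw [hDdef]; linarith
  set s := Real.sqrt D with hsdef
  have hs2 : s ^ 2 = D := Real.sq_sqrt hD.le
  have hs_le : s ≤ 1 - Z := by
    rw [hsdef]
    calc Real.sqrt D ≤ Real.sqrt ((1 - Z) ^ 2) := Real.sqrt_le_sqrt (by rw [hDdef]; nlinarith)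
      _ = 1 - Z := Real.sqrt_sq ha.le
  have hZr : Z₂ * r < 1 - Z := by
    have := (lt_div_iff₀ hZ₂pos).1 hrmax
    linarith
  have hrs : 1 - Z - s ≤ Z₂ * r := by
    have := (div_le_iff₀ hZ₂pos).1 hrmin
    linarith
  have hr : 0 ≤ r := by
    by_contra hneg
    have : Z₂ * r < 0 := mul_neg_of_pos_of_neg hZ₂pos (not_le.mp hneg)
    linarith
  have hK0 : 0 ≤ Z + Z₂ * r := by positivity
  have hK1 : Z + Z₂ * r < 1 := by linarith
  have hP : Z₂ * r ^ 2 / 2 + Z * r + Y₀ ≤ r := by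
    have hb : 0 ≤ 1 - Z - Z₂ * r := by linarith
    have hbs : 1 - Z - Z₂ * r ≤ s := by linarith
    have hsq : (1 - Z - Z₂ * r) ^ 2 ≤ s ^ 2 := pow_le_pow_left₀ hb hbs 2
    rw [hs2, hDdef] at hsq
    nlinarith [hsq, hZ₂pos]
  -- `‖DT(x)‖ ≤ Z + Z₂‖x − x̄‖`
  have hDg : ∀ x, ‖ContinuousLinearMap.id ℝ X - A.comp (F' x)‖ ≤ Z + Z₂ * ‖x - xbar‖ :=
    fun x => by rw [hZdef]; exact norm_id_sub_comp_le_of_bounds hZ₀ hZ₁ hZ₂ x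
  -- `T` is `(Z + Z₂ r)`-Lipschitz on the ball (mean value inequality)
  have hlip : ∀ x ∈ closedBall xbar r, ∀ y ∈ closedBall xbar r,
      ‖g y - g x‖ ≤ (Z + Z₂ * r) * ‖y - x‖ :=
    fun x hx y hy => (convex_closedBall xbar r).norm_image_sub_le_of_norm_hasFDerivWithin_le
      (fun z _ => (hasFDerivAt_newtonLikeMap (hF z)).hasFDerivWithinAt)
      (fun z hz => (hDg z).trans (by
        have := mem_closedBall_iff_norm.1 hz
        nlinarith [hZ₂pos]))
      hx hy
  -- `T` maps the ball into itself (path estimate with the bound `Z‖v‖ + Z₂‖v‖² t` on `DT(x̄ + tv) v`)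
  have hga : g xbar - xbar = -A (F xbar) := by
    simp [hg, newtonLikeMap_apply]
  have hmaps : MapsTo g (closedBall xbar r) (closedBall xbar r) := by
    intro x hx
    have hρ : ‖x - xbar‖ ≤ r := mem_closedBall_iff_norm.1 hx
    set v := x - xbar with hv
    have hder : ∀ t : ℝ, HasDerivAt (fun t : ℝ => g (xbar + t • v) - g xbar)
        ((ContinuousLinearMap.id ℝ X - A.comp (F' (xbar + t • v))) v) t := by
      intro t
      have hp : HasDerivAt (fun t : ℝ => xbar + t • v) v t := by
        simpa using ((hasDerivAt_id t).smul_const v).const_add xbar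
      exact ((hasFDerivAt_newtonLikeMap (hF (xbar + t • v))).comp_hasDerivAt t hp).sub_const (g xbar)
    have hBd : ∀ t : ℝ, HasDerivAt (fun t : ℝ => Z * ‖v‖ * t + Z₂ * ‖v‖ ^ 2 / 2 * (t * t))
        (Z * ‖v‖ + Z₂ * ‖v‖ ^ 2 * t) t := by
      intro t
      have h := ((hasDerivAt_id' t).const_mul (Z * ‖v‖)).add
        (((hasDerivAt_id' t).mul (hasDerivAt_id' t)).const_mul (Z₂ * ‖v‖ ^ 2 / 2))
      refine h.congr_deriv ?_
      ring
    have key := image_norm_le_of_norm_deriv_right_le_deriv_boundary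
      (f := fun t : ℝ => g (xbar + t • v) - g xbar)
      (f' := fun t => (ContinuousLinearMap.id ℝ X - A.comp (F' (xbar + t • v))) v) (a := 0) (b := 1)
      (B := fun t => Z * ‖v‖ * t + Z₂ * ‖v‖ ^ 2 / 2 * (t * t))
      (B' := fun t => Z * ‖v‖ + Z₂ * ‖v‖ ^ 2 * t)
      (fun t _ => (hder t).continuousAt.continuousWithinAt)
      (fun t _ => (hder t).hasDerivWithinAt)
      (by simp) hBd
      (fun t ht => by
        have ht0 : 0 ≤ t := ht.1
        calc ‖(ContinuousLinearMap.id ℝ X - A.comp (F' (xbar + t • v))) v‖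
            ≤ ‖ContinuousLinearMap.id ℝ X - A.comp (F' (xbar + t • v))‖ * ‖v‖ :=
              ContinuousLinearMap.le_opNorm _ _
          _ ≤ (Z + Z₂ * ‖xbar + t • v - xbar‖) * ‖v‖ := by
              gcongr
              exact hDg _
          _ = Z * ‖v‖ + Z₂ * ‖v‖ ^ 2 * t := by
              rw [add_sub_cancel_left, norm_smul, Real.norm_eq_abs, abs_of_nonneg ht0]
              ring)
    have hk := key (right_mem_Icc.mpr zero_le_one)
    simp only [one_smul, mul_one] at hk
    have hx' : xbar + v = x := by rw [hv]; abel
    rw [hx'] at hk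
    rw [mem_closedBall_iff_norm]
    calc ‖g x - xbar‖ = ‖(g x - g xbar) + (g xbar - xbar)‖ := by abel_nf
      _ ≤ ‖g x - g xbar‖ + ‖g xbar - xbar‖ := norm_add_le _ _
      _ ≤ (Z * ‖v‖ + Z₂ * ‖v‖ ^ 2 / 2) + Y₀ := by
          refine add_le_add hk ?_
          rw [hga, norm_neg]
          exact hY
      _ ≤ Z * r + Z₂ * r ^ 2 / 2 + Y₀ := by
          have hv0 : 0 ≤ ‖v‖ := norm_nonneg _
          nlinarith [mul_le_mul hρ hρ hv0 hr, hZ₂pos.le, mul_le_mul_of_nonneg_left hρ hZ']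
      _ ≤ r := by linarith [hP]
  -- Banach's fixed point theorem on the complete subset `closedBall xbar r`
  obtain ⟨K, hK⟩ : ∃ K : NNReal, (K : ℝ) = Z + Z₂ * r := ⟨⟨Z + Z₂ * r, hK0⟩, rfl⟩
  have hK₁ : K < 1 := by
    rw [← NNReal.coe_lt_coe, hK, NNReal.coe_one]
    exact hK1
  have hlipK : LipschitzOnWith K g (closedBall xbar r) := by
    refine LipschitzOnWith.of_dist_le_mul fun x hx y hy => ?_
    rw [dist_eq_norm, dist_eq_norm, hK]
    exact hlip y hy x hx
  have hc : ContractingWith K (hmaps.restrict g _ _) := ⟨hK₁, hlipK.mapsToRestrict hmaps⟩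
  obtain ⟨x, hx, hfix, -, -⟩ :=
    hc.exists_fixedPoint' isClosed_closedBall.isComplete hmaps (mem_closedBall_self hr)
      (edist_ne_top _ _)
  have hfx : F x = 0 := (newtonLikeMap_eq_self_iff hA F x).1 hfix
  refine ⟨x, hx, hfx, fun y hy hfy => ?_⟩
  -- uniqueness: two fixed points of a strict contraction coincide
  have hgy : g y = y := (newtonLikeMap_eq_self_iff hA F y).2 hfy
  have hle : ‖y - x‖ ≤ (Z + Z₂ * r) * ‖y - x‖ := by
    have := hlip x hx y hy
    rwa [hgy, show g x = x from hfix] at this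
  have h0 : ‖y - x‖ = 0 := by
    nlinarith [norm_nonneg (y - x)]
  exact sub_eq_zero.1 (norm_eq_zero.1 h0)

end Main

end Literature.Analysis.Calculus

end
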